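import Mathlib
import HarnessLib
import Summits.BirchSwinnertonDyer.BirchSwinnertonDyer.Theses.ManinLocalTwoThree
import Literature.NumberTheory.EllipticCurves.ManinConstantSemistablePrimewise
import Literature.NumberTheory.EllipticCurves.ManinConstantClassCertificateTwistGamma0Proofs
import Literature.NumberTheory.EllipticCurves.ManinConstantClassCertificate
import Literature.NumberTheory.EllipticCurves.IsogenyIdProofs
import Literature.NumberTheory.EllipticCurves.IsogenyDualProofs
import Literature.NumberTheory.EllipticCurves.SzpiroLocalDataProofs
import Summits.BirchSwinnertonDyer.Rank1Residual.Additive.GordTwistMinimalModel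
import Summits.BirchSwinnertonDyer.Rank1Residual.ManinAdditive.TwistOrbitDegreeIdentity

/-!
# Route `ManinLocalTwoThree`, crux C3 `ManinPrimeToThreeAtNine` (stmt-BirchSwinnertonDyer-22968),
# birth line `Lines/birth.lean`: STUB 1 `stub_twistCoveredAtThree` PROVED

The twist-covered half of Manin's conjecture at the prime `3` (modulo the four printed facts the
crux carries as leading hypotheses): for a globally minimal `W/ℚ` with a lattice-optimal
`X₀(N)`-datum `D`, `9 ∣ N`, whose isogeny class is the `χ₋₃`-twist of a class with `9 ∤ N'`
(`W ∼ W' ⊗ ℚ(√−3)`, `W'` globally minimal), `3 ∤ c(D)`.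

The tree's `Γ₀`-road certificate `not_dvd_maninConstant_of_isTwistOfSemistableAt_gamma0` at
`q = 3` proves this from two further side conditions, `N(W') ∣ N(W)` and "`W` additive at `3`";
this file DISCHARGES both from the stub's own binders, so the stub is closed AS STATED:
* the level of the datum is the conductor (`IsNewformOf.level_eq_conductorNorm_of_exists_isNewformOf`,
  modularity `hnf` + strong multiplicity one), so `9 ∣ N(W)` and `W` is additive at `3`
  (`ManinAdditive.not_good_and_not_mult_of_sq_dvd_conductorNorm`);
* `N(W) = N(W' ⊗ χ₋₃)` (isogenous curves have the same newform, hence the same level: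
  `level_eq_conductorNorm_of_isIsogenous`), and prime by prime `f_p(W' ⊗ χ₋₃) = f_p(W')` for
  `p ≠ 3` because `χ₋₃` is unramified off `3` (`−3 ≡ 1 (mod 4)`;
  `Additive.conductorExponent_eq_of_twist_pStar_of_ne` at `p* = −3`), while at `3`:
  `f₃(W') ≤ 1 < 2 ≤ f₃(W)`; so `N(W') ∣ N(W)` (`conductorNorm_dvd_of_forall_conductorExponent_le`).
Nothing about BSD is proved here; Manin's conjecture at `3` remains open on the twist-minimal
classes (`stub_twistMinimalAtThree`).
-/

set_option autoImplicit false
set_option linter.dupNamespace false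

noncomputable section

namespace Summit.BirchSwinnertonDyer.BirchSwinnertonDyer.Theorems

open WeierstrassCurve IsDedekindDomain Rat.HeightOneSpectrum
  Literature.NumberTheory.EllipticCurves Literature.NumberTheory.EllipticCurves.ModularForms

/-- **Conductor bookkeeping for a `χ₋₃`-twist pair.** If an elliptic `W/ℚ` carrying an
`X₀(N)`-parametrisation datum is isogenous to `W' ⊗ ℚ(√−3)` with `9 ∣ N` and `9 ∤ N(W')`, then
`N(W') ∣ N(W)` (granted modularity `exists_isNewformOf`): the level `N` is both `N(W)` and
`N(W' ⊗ χ₋₃)`; off `3` the conductor exponents of `W' ⊗ χ₋₃` and `W'` agree (`χ₋₃` is unramified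
there), and at `3` one has `f₃(W') ≤ 1 < 2 ≤ f₃(W)`.
[cite: SilvermanATAEC1994, IV.9.4 (PDF pp. 344–346)] [cite: DiamondShurman2005, Thm. 8.8.1] -/
theorem maninLocalTwoThree_conductorNorm_dvd_of_isIsogenous_twist_negThree
    (hnf : exists_isNewformOf)
    {W : WeierstrassCurve ℚ} [W.IsElliptic] {N : ℕ} [NeZero N]
    (D : ModularParametrizationData W N)
    {W' : WeierstrassCurve ℚ} [W'.IsElliptic]
    (htw : IsIsogenous W (W'.quadraticTwist ((-3 : ℤ) : ℚ)))
    (h9 : 3 ^ 2 ∣ N) (h9' : ¬ 3 ^ 2 ∣ W'.conductorNorm ℤ) :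
    W'.conductorNorm ℤ ∣ W.conductorNorm ℤ := by
  have hd0 : ((-3 : ℤ) : ℚ) ≠ 0 := by norm_num
  haveI : (W'.quadraticTwist ((-3 : ℤ) : ℚ)).IsElliptic := W'.isElliptic_quadraticTwist hd0
  have hNW : N = W.conductorNorm ℤ :=
    IsNewformOf.level_eq_conductorNorm_of_exists_isNewformOf hnf D.isNewformOf
  have hNV : N = (W'.quadraticTwist ((-3 : ℤ) : ℚ)).conductorNorm ℤ :=
    level_eq_conductorNorm_of_isIsogenous hnf D htw.symm_of_charZero
  have hB : W.conductorNorm ℤ ≠ 0 := (conductorNorm_pos_holds W).ne'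
  refine conductorNorm_dvd_of_forall_conductorExponent_le W' hB fun p ↦ ?_
  rw [factorization_conductorNorm_primesEquiv_symm W p]
  by_cases hp3 : (p : ℕ) = 3
  · -- at `3`: `f₃(W') ≤ 1 < 2 ≤ f₃(W)`
    have h1 : W'.conductorExponent ((primesEquiv (R := ℤ)).symm p) ≤ 1 := by
      rw [← factorization_conductorNorm_primesEquiv_symm W' p, hp3]
      by_contra h
      push Not at h
      exact h9' ((Nat.prime_three.pow_dvd_iff_le_factorization
        (conductorNorm_pos_holds W').ne').mpr h)
    have h2 : 2 ≤ W.conductorExponent ((primesEquiv (R := ℤ)).symm p) := by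
      rw [← factorization_conductorNorm_primesEquiv_symm W p, hp3, ← hNW]
      exact (Nat.prime_three.pow_dvd_iff_le_factorization (NeZero.ne N)).mp h9
    omega
  · -- off `3`: `f_p(W) = f_p(W' ⊗ χ₋₃) = f_p(W')`
    have hgen : natGenerator ((primesEquiv (R := ℤ)).symm p) = p :=
      natGenerator_primesEquiv_symm p.2
    have hC : (1 : VariableChange ℚ) • W'.quadraticTwist ((-1 : ℚ) ^ (3 / 2) * 3) =
        W'.quadraticTwist ((-3 : ℤ) : ℚ) := by
      rw [one_smul]; norm_num
    have hVW' : (W'.quadraticTwist ((-3 : ℤ) : ℚ)).conductorExponent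
        ((primesEquiv (R := ℤ)).symm p) = W'.conductorExponent ((primesEquiv (R := ℤ)).symm p) :=
      Summit.BirchSwinnertonDyer.Rank1Residual.Additive.conductorExponent_eq_of_twist_pStar_of_ne
        3 (by decide) W' _ 1 hC _ (by rw [hgen]; exact hp3)
    have hWV : W.conductorExponent ((primesEquiv (R := ℤ)).symm p) =
        (W'.quadraticTwist ((-3 : ℤ) : ℚ)).conductorExponent ((primesEquiv (R := ℤ)).symm p) := by
      rw [← factorization_conductorNorm_primesEquiv_symm W p,
        ← factorization_conductorNorm_primesEquiv_symm _ p, ← hNW, ← hNV]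
    rw [hWV, hVW']

/-- **C3 birth line, STUB 1 `stub_twistCoveredAtThree` (crux `ManinPrimeToThreeAtNine`,
stmt-BirchSwinnertonDyer-22968), PROVED AS STATED**: modulo the printed semistable-prime Manin
facts and modularity, for every globally minimal `W/ℚ`, every lattice-optimal `X₀(N)`-datum `D` of
`W` with `9 ∣ N`, if the class of `W` is the `χ₋₃`-twist of a class semistable at `3`
(`W ∼ W' ⊗ ℚ(√−3)`, `W'` globally minimal, `9 ∤ N(W')`), then `3 ∤ D.maninConstant`. The tree's
`Γ₀` certificate `not_dvd_maninConstant_of_isTwistOfSemistableAt_gamma0` at `q = 3` (Stevens 1989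
(5.2) twist transport + Česnavičius 2018 at `9 ∤ N(W')`), with its side conditions `N(W') ∣ N(W)`
and additivity of `W` at `3` discharged here. [cite: Stevens1989, Lemmas (5.2), (5.4)]
[cite: Cesnavicius2018, Thm. 1.2] -/
theorem maninLocalTwoThree_maninPrimeToThreeAtNine_twistCovered :
    Literature.NumberTheory.EllipticCurves.ModularForms.mazur_not_dvd_maninConstant_of_odd →
    Literature.NumberTheory.EllipticCurves.ModularForms.abbesUllmo_not_dvd_maninConstant_of_not_dvd_level →
    Literature.NumberTheory.EllipticCurves.ModularForms.cesnavicius_not_two_dvd_maninConstant_of_two_dvd_level →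
    Literature.NumberTheory.EllipticCurves.ModularForms.exists_isNewformOf →
    ∀ (W : WeierstrassCurve ℚ) [W.IsElliptic] [W.IsGloballyMinimal] {N : ℕ} [NeZero N]
      (D : ModularParametrizationData W N),
      (∀ z ∈ D.L.lattice, ∃ w ∈ periodLattice D.f, z = D.c * w) → 3 ^ 2 ∣ N →
      (∃ (W' : WeierstrassCurve ℚ) (d : ℤ), W'.IsElliptic ∧ W'.IsGloballyMinimal ∧
        (d = -3) ∧ IsIsogenous W (W'.quadraticTwist (d : ℚ)) ∧
        ¬ 3 ^ 2 ∣ W'.conductorNorm ℤ) →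
      ¬ (3 : ℤ) ∣ D.maninConstant := by
  intro hM hAU hC2 hnf W _ _ N _ D hopt h9 hex
  obtain ⟨W', d, hE', hM', hd, htw, h9'⟩ := hex
  subst hd
  haveI := hE'
  haveI := hM'
  have hNW : N = W.conductorNorm ℤ :=
    IsNewformOf.level_eq_conductorNorm_of_exists_isNewformOf hnf D.isNewformOf
  have h9W : 3 ^ 2 ∣ W.conductorNorm ℤ := hNW ▸ h9
  have hadd : ¬ W.HasGoodReductionAtPrime 3 ∧ ¬ W.HasMultiplicativeReductionAtPrime 3 :=
    Summit.BirchSwinnertonDyer.Rank1Residual.ManinAdditive.not_good_and_not_mult_of_sq_dvd_conductorNorm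
      W h9W
  have hN'N : W'.conductorNorm ℤ ∣ W.conductorNorm ℤ :=
    maninLocalTwoThree_conductorNorm_dvd_of_isIsogenous_twist_negThree hnf D htw h9 h9'
  have htw' : IsIsogenous W (W'.quadraticTwist (((-1 : ℤ) ^ (3 / 2) * 3 : ℤ) : ℚ)) := by
    have h : ((-1 : ℤ) ^ (3 / 2) * 3 : ℤ) = -3 := by norm_num
    rw [h]
    exact htw
  exact not_dvd_maninConstant_of_isTwistOfSemistableAt_gamma0 hM hAU hC2 hnf (q := 3) (by decide)
    htw' hN'N h9W h9' hadd W D (isIsogenous_self W) hopt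

end Summit.BirchSwinnertonDyer.BirchSwinnertonDyer.Theorems

end
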